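import Literature.AnabelianGeometry.SemiGraphs.TemperedPiDecompositionStab
import Literature.AnabelianGeometry.SemiGraphs.TemperedPiCoverMaps
import HarnessLib

/-!
# Every point of `𝒢_{∞,j}` and every vertex of `𝔾̃_j` lies under a compatible point sequence ([SemiAnbd] §3 pp. 38, 41)

Mochizuki, *Semi-graphs of anabelioids*, Publ. RIMS **42** (2006) [MochizukiSemiAnbd2006], §3: proof of
Prop. 3.6, author's manuscript p. 38 ("compatible maps `𝒢_{∞,j} → 𝒢_{∞,i}`") [cite: MochizukiSemiAnbd2006,
Prop 3.6 p.38] and proof of Thm. 3.7 (iii), p. 41 ("a compatible system of vertices of `𝒢_{∞,j}`")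
[cite: MochizukiSemiAnbd2006, Thm 3.7(iii) p.41].

PROOF-ONLY file (abc-iut cell, FRONTIER programme REFUTE-F1732, brick R6c «POINTSEQ-COVER», named by
abc-iut-L3-d4 2026-08-26T10:52:49Z; seat abc-iut-w5-d160 gen 6; no definitions, no named facts).  For a
Galois tower `D : GaloisLevelData 𝒢` (abc-iut-L3-t9) and abc-iut-L3-t6's compatible point sequences
`D.PointSeq h𝒢 v` (`TemperedPiDecomposition.lean`, with `exists_pointSeq_vertex_eq` of
`TemperedPiDecompositionStab.lean` for compatible vertex SYSTEMS):

* `coverMap_comp`, `coverMap_le_succ`, `coverMap_comp_apply`, `stepCover_coverMap_apply`,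
  `coverMap_stepCover_apply`, `coverMap_self_apply` — functoriality of the composite transition maps
  `coverMap : 𝒢_{∞,m} ⟶ 𝒢_{∞,n}` of `TemperedPiCoverMaps.lean` and their two one-step peelings, pointwise
  on vertex fibres;
* **`exists_pointSeq_pt_eq`** — every point `t ∈ (𝒢_{∞,j})_v` of every level lies on a compatible point
  sequence `P` over `v` with `P.pt j = t`, whose points below level `j` are the images of `t` under the
  transition maps (above `j`: successive choices of preimages under the fibre-surjective covering maps,
  `levelMap_fV_surjective`; below `j`: the transition maps themselves);
* `exists_pointSeq_vertex_eq_mk` / **`exists_pointSeq_vertex_eq_at_base`** — every vertex `y` of the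
  tree `𝔾̃_j = D.tree j` is the level-`j` vertex `P.vertex j` of a compatible point sequence `P` over ITS
  base vertex `(D.treeProj j) y` of `𝔾` (the base-pinned form of abc-iut-L3-d4's
  `GaloisLevelData.exists_pointSeq_vertex_eq_at : ∃ v P, P.vertex j = y` of `ThetaRayCritical.lean`, which
  landed first and is NOT restated here; likewise its `treeStep_vertexMap_surjective`);
* `treeTrans_vertexMap_surjective` — the transition morphisms of the trees `𝔾̃_j → 𝔾̃_i` (`i ≤ j`) are
  surjective on vertices.

The base-pinned form feeds abc-iut-L3-t11's `PointSeq.exists_gal_conj_brHom_of_edgeMap_eq` (stated at a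
vertex `P.vertex n` of a point sequence over the vertex `w` to which the branch `b` of `𝔾` abuts) at an
ARBITRARY tree vertex without a separate base-vertex identification.  Print proves [SemiAnbd] Thm 3.7 for
finite `𝔾`; nothing here bears on [IUTchIII] Cor. 3.12; typed ≠ proved.
-/

namespace Literature.AnabelianGeometry.SemiGraphs

namespace ProfiniteSemiGraph

namespace GaloisLevelData

open CategoryTheory

universe u

variable {𝒢 : ProfiniteSemiGraph.{u}} (D : GaloisLevelData 𝒢) (h𝒢 : 𝒢.IsCountable)

/-! ### Functoriality and peeling of the transition maps `coverMap` -/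

/-- Functoriality of the composite transition maps `𝒢_{∞,k} ⟶ 𝒢_{∞,j} ⟶ 𝒢_{∞,i}`.
[cite: MochizukiSemiAnbd2006, Prop 3.6 p.38] -/
theorem coverMap_comp {i j k : ℕ} (hij : i ≤ j) (hjk : j ≤ k) :
    D.coverMap h𝒢 hjk ≫ D.coverMap h𝒢 hij = D.coverMap h𝒢 (hij.trans hjk) := by
  induction k, hjk using Nat.le_induction with
  | base => rw [coverMap_self, Category.id_comp]
  | succ k hjk ih =>
    rw [D.coverMap_succ h𝒢 hjk, D.coverMap_succ h𝒢 (hij.trans hjk), Category.assoc, ih]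

/-- The one-step transition map `coverMap (n ≤ n+1)` is the covering map `stepCover n` of the tower.
[cite: MochizukiSemiAnbd2006, Prop 3.6 p.38] -/
theorem coverMap_le_succ (n : ℕ) : D.coverMap h𝒢 (Nat.le_succ n) = D.stepCover h𝒢 n := by
  rw [D.coverMap_succ h𝒢 (le_refl n), D.coverMap_self, Category.comp_id]
  rfl

/-- `coverMap le_rfl` is the identity, pointwise. [cite: MochizukiSemiAnbd2006, Prop 3.6 p.38] -/
theorem coverMap_self_apply (n : ℕ) {v : 𝒢.graph.Vertex} (t : ((D.cover h𝒢 n).SV v).obj.V) :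
    ((D.coverMap h𝒢 (le_refl n)).fV v).hom.hom t = t := by
  rw [D.coverMap_self]
  rfl

/-- Functoriality of the transition maps, pointwise: `coverMap (i ≤ j) (coverMap (j ≤ k) t) =
coverMap (i ≤ k) t`. [cite: MochizukiSemiAnbd2006, Prop 3.6 p.38] -/
theorem coverMap_comp_apply {i j k : ℕ} (hij : i ≤ j) (hjk : j ≤ k) {v : 𝒢.graph.Vertex}
    (t : ((D.cover h𝒢 k).SV v).obj.V) :
    ((D.coverMap h𝒢 hij).fV v).hom.hom (((D.coverMap h𝒢 hjk).fV v).hom.hom t) =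
      ((D.coverMap h𝒢 (hij.trans hjk)).fV v).hom.hom t :=
  congrArg (fun φ : D.cover h𝒢 k ⟶ D.cover h𝒢 i => (φ.fV v).hom.hom t) (D.coverMap_comp h𝒢 hij hjk)

/-- Peeling the LOWEST step, pointwise: `stepCover n (coverMap (n+1 ≤ m) t) = coverMap (n ≤ m) t`.
[cite: MochizukiSemiAnbd2006, Prop 3.6 p.38] -/
theorem stepCover_coverMap_apply {n m : ℕ} (h : n + 1 ≤ m) {v : 𝒢.graph.Vertex}
    (t : ((D.cover h𝒢 m).SV v).obj.V) :
    ((D.stepCover h𝒢 n).fV v).hom.hom (((D.coverMap h𝒢 h).fV v).hom.hom t) =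
      ((D.coverMap h𝒢 ((Nat.le_succ n).trans h)).fV v).hom.hom t := by
  have e := D.coverMap_comp h𝒢 (Nat.le_succ n) h
  rw [D.coverMap_le_succ] at e
  exact congrArg (fun φ : D.cover h𝒢 m ⟶ D.cover h𝒢 n => (φ.fV v).hom.hom t) e

/-- Peeling the HIGHEST step, pointwise: `coverMap (n ≤ k+1) t = coverMap (n ≤ k) (stepCover k t)`.
[cite: MochizukiSemiAnbd2006, Prop 3.6 p.38] -/
theorem coverMap_stepCover_apply {n k : ℕ} (h : n ≤ k) {v : 𝒢.graph.Vertex}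
    (t : ((D.cover h𝒢 (k + 1)).SV v).obj.V) :
    ((D.coverMap h𝒢 (h.trans (Nat.le_succ k))).fV v).hom.hom t =
      ((D.coverMap h𝒢 h).fV v).hom.hom (((D.stepCover h𝒢 k).fV v).hom.hom t) :=
  congrArg (fun φ : D.cover h𝒢 (k + 1) ⟶ D.cover h𝒢 n => (φ.fV v).hom.hom t)
    (D.coverMap_succ h𝒢 h (h.trans (Nat.le_succ k)))

/-! ### Every point lies on a compatible point sequence -/

/-- **Every point `t ∈ (𝒢_{∞,j})_v` of every level of the tower lies on a compatible point sequence over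
`v`**: there is `P : D.PointSeq h𝒢 v` with `P.pt j = t`, whose points BELOW level `j` are the images of `t`
under the transition maps `𝒢_{∞,j} ⟶ 𝒢_{∞,n}`.  (Above `j`: points `L k ∈ (𝒢_{∞,j+k})_v` over `t` by
successive choices of preimages under the fibre-surjective covering maps of the tower — dependent choice;
then `P.pt n :=` the image of `L n` in level `n`.) [cite: MochizukiSemiAnbd2006, Thm 3.7(iii) p.41] -/
theorem exists_pointSeq_pt_eq (j : ℕ) {v : 𝒢.graph.Vertex} (t : ((D.cover h𝒢 j).SV v).obj.V) :
    ∃ P : D.PointSeq h𝒢 v, P.pt j = t ∧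
      ∀ ⦃n : ℕ⦄ (h : n ≤ j), P.pt n = ((D.coverMap h𝒢 h).fV v).hom.hom t := by
  /- (1) points `L k ∈ (𝒢_{∞,j+k})_v` above `t`, by successive choices of preimages under the covering
  maps `𝒢_{∞,j+k+1} → 𝒢_{∞,j+k}` (onto on vertex fibres, `levelMap_fV_surjective`) -/
  obtain ⟨L, hL0, hLs⟩ : ∃ L : ∀ k : ℕ, ((D.cover h𝒢 (j + k)).SV v).obj.V, L 0 = t ∧
      ∀ k, ((D.stepCover h𝒢 (j + k)).fV v).hom.hom (L (k + 1)) = L k :=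
    ⟨fun k => Nat.rec (motive := fun k => ((D.cover h𝒢 (j + k)).SV v).obj.V) t
        (fun k x => (D.levelMap_fV_surjective h𝒢 (j + k) v x).choose) k, rfl,
      fun k => (D.levelMap_fV_surjective h𝒢 (j + k) v _).choose_spec⟩
  subst hL0
  /- (2) the `L k` are compatible under all the transition maps `𝒢_{∞,j+b} ⟶ 𝒢_{∞,j+a}` -/
  have hLle : ∀ {a b : ℕ} (hab : a ≤ b),
      ((D.coverMap h𝒢 (Nat.add_le_add_left hab j)).fV v).hom.hom (L b) = L a := by
    intro a b hab
    induction b, hab using Nat.le_induction with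
    | base => exact D.coverMap_self_apply h𝒢 (j + a) _
    | succ b hab ih =>
      calc _ = ((D.coverMap h𝒢 (Nat.add_le_add_left hab j)).fV v).hom.hom
              (((D.stepCover h𝒢 (j + b)).fV v).hom.hom (L (b + 1))) :=
            D.coverMap_stepCover_apply h𝒢 (Nat.add_le_add_left hab j) _
        _ = L a := by rw [hLs, ih]
  /- (3) hence, in a fixed level `n`, the images of all the `L k` (`n ≤ j + k`) agree with that of `L n`
  (compare both with the image of `L (n + k)`) -/
  have key : ∀ {n k : ℕ} (h : n ≤ j + k), ((D.coverMap h𝒢 h).fV v).hom.hom (L k) =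
      ((D.coverMap h𝒢 (Nat.le_add_left n j)).fV v).hom.hom (L n) := fun {n k} h =>
    calc ((D.coverMap h𝒢 h).fV v).hom.hom (L k)
        = ((D.coverMap h𝒢 h).fV v).hom.hom
            (((D.coverMap h𝒢 (Nat.add_le_add_left (Nat.le_add_left k n) j)).fV v).hom.hom
              (L (n + k))) := by rw [hLle (Nat.le_add_left k n)]
      _ = ((D.coverMap h𝒢 (h.trans (Nat.add_le_add_left (Nat.le_add_left k n) j))).fV v).hom.hom
            (L (n + k)) := D.coverMap_comp_apply h𝒢 _ _ _
      _ = ((D.coverMap h𝒢 ((Nat.le_add_left n j).trans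
            (Nat.add_le_add_left (Nat.le_add_right n k) j))).fV v).hom.hom (L (n + k)) := rfl
      _ = ((D.coverMap h𝒢 (Nat.le_add_left n j)).fV v).hom.hom
            (((D.coverMap h𝒢 (Nat.add_le_add_left (Nat.le_add_right n k) j)).fV v).hom.hom
              (L (n + k))) := (D.coverMap_comp_apply h𝒢 _ _ _).symm
      _ = ((D.coverMap h𝒢 (Nat.le_add_left n j)).fV v).hom.hom (L n) := by
          rw [hLle (Nat.le_add_right n k)]
  /- (4) the point sequence `P.pt n :=` the image of `L n` in level `n` -/
  refine ⟨⟨fun n => ((D.coverMap h𝒢 (Nat.le_add_left n j)).fV v).hom.hom (L n), fun n => ?_⟩, ?_, ?_⟩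
  · -- compatibility under the covering maps of the tower
    calc ((D.stepCover h𝒢 n).fV v).hom.hom
          (((D.coverMap h𝒢 (Nat.le_add_left (n + 1) j)).fV v).hom.hom (L (n + 1)))
        = ((D.coverMap h𝒢 ((Nat.le_succ n).trans (Nat.le_add_left (n + 1) j))).fV v).hom.hom
            (L (n + 1)) := D.stepCover_coverMap_apply h𝒢 _ _
      _ = ((D.coverMap h𝒢 (Nat.le_add_left n j)).fV v).hom.hom (L n) := key _
  · -- the `j`-th point is `t = L 0`
    exact (key (k := 0) (le_refl j)).symm.trans (D.coverMap_self_apply h𝒢 j (L 0))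
  · -- below `j`: the images of `t = L 0`
    intro n h
    exact (key (k := 0) h).symm

/-! ### Every tree vertex lies under a compatible point sequence -/

/-- The vertex `[t]` of `𝔾̃_j` under a point `t ∈ (𝒢_{∞,j})_v` is the level-`j` vertex of a compatible
point sequence over `v`. [cite: MochizukiSemiAnbd2006, Thm 3.7(iii) p.41] -/
theorem exists_pointSeq_vertex_eq_mk (j : ℕ) {v : 𝒢.graph.Vertex} (t : ((D.cover h𝒢 j).SV v).obj.V) :
    ∃ P : D.PointSeq h𝒢 v, P.vertex j = (D.treeIso h𝒢 j).hom.vertexMap (Quot.mk _ ⟨v, t⟩) := by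
  obtain ⟨P, hP, -⟩ := D.exists_pointSeq_pt_eq h𝒢 j t
  exact ⟨P, congrArg (fun s => (D.treeIso h𝒢 j).hom.vertexMap (Quot.mk _ ⟨v, s⟩)) hP⟩

/-- **Every vertex of the tree `𝔾̃_j` lies under a compatible point sequence over ITS base vertex of
`𝔾`**: `y = P.vertex j` for some `P : D.PointSeq h𝒢 ((D.treeProj j) y)` (a point over `y` exists —
`exists_point_over` — and every point lies on a compatible point sequence).  Base-pinned form of
abc-iut-L3-d4's `exists_pointSeq_vertex_eq_at` (`ThetaRayCritical.lean`). [cite: MochizukiSemiAnbd2006, Thm 3.7(iii) p.41] -/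
theorem exists_pointSeq_vertex_eq_at_base (j : ℕ) (y : (D.tree j).Vertex) :
    ∃ P : D.PointSeq h𝒢 ((D.treeProj j).vertexMap y), P.vertex j = y := by
  obtain ⟨t, ht⟩ := exists_point_over (h𝒢 := h𝒢) j y (D.treeProj_vertexMap j y).symm
  obtain ⟨P, hP⟩ := D.exists_pointSeq_vertex_eq_mk h𝒢 j t
  exact ⟨P, hP.trans ht⟩

/-! ### The transition morphisms of the trees are surjective on vertices -/

include h𝒢 in
/-- **The transition morphism `𝔾̃_j → 𝔾̃_i` (`i ≤ j`) is surjective on vertices** (one step: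
abc-iut-L3-d4's `treeStep_vertexMap_surjective`, `ThetaRayCritical.lean`). [cite: MochizukiSemiAnbd2006, Thm 3.7(iii) p.41] -/
theorem treeTrans_vertexMap_surjective {i j : ℕ} (h : i ≤ j) :
    Function.Surjective (D.treeTrans h).vertexMap := by
  intro y
  obtain ⟨P, hP⟩ := D.exists_pointSeq_vertex_eq_at_base h𝒢 i y
  exact ⟨P.vertex j, (P.treeTrans_vertex h).trans hP⟩

end GaloisLevelData

end ProfiniteSemiGraph

end Literature.AnabelianGeometry.SemiGraphs
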